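import Summits.AtomisticToContinuum.BoseEinsteinCondensation.Theses.BECIntegerBlockRotor
import Literature.MathematicalPhysics.QuantumManyBody.LiebYngvasonLowerBound
import HarnessLib.Audit

/-!
# Birth skeleton for crux `BECIntegerBlockRotor.BlockCondensation`
(item stmt-AtomisticToContinuum-13595, rank 5, route route-AtomisticToContinuum-BECIntegerBlockRotor, sub-problem
`BoseEinsteinCondensation`; skeleton-register seat planner-skel-stmt-AtomisticToContinuum-13595-0, 2026-08-17;
published as `Cruxes/BlockCondensation/Lines/birth.lean`)

Crux (FIXED, concluded BY NAME below): `BlockCondensation` — INTRA-BLOCK BEC SUMMED OVER BLOCKS, box-uniform,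
no integer-filling hypothesis: for every repulsive finite-range `v`, every `A > 0` and `η > 0` there are `ρ₀, N₀`
such that on every periodic box (`N ≥ N₀`, `N ≤ ρ₀L³`), for some `δ > 0`, every `δ`-near-minimiser `Ψ` of the
periodic energy and every even `K > 0` with block side `L/K ∈ [A, 2A]·(N/L³)^(-1/2)` satisfy
`Σ_B ⟨u_B, γ_Ψ u_B⟩ ≥ (1 − η)N`, `u_B = (L/K)^(-3/2) 1_{⌊Kx/L⌋ = B}` the normalised indicators of the `K³`
blocks `Q_B` (LSSY Thm 5.1 localised to the healing-scale Neumann blocks of a torus near-minimiser, uniformly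
in `K`).

## The line: PINNED NEUMANN BRACKETING (the route's foreseen split "NeumannBlockBracketing → PerBlockGapStep",
with the pinning term of Fournais–Junge–… carried through the bracketing so that the two halves meet in ONE
configuration-space functional)

Write `l = L/K`, `n_B(X) = #{i : xᵢ ∈ Q_B}` (block particle numbers of a configuration `X ∈ [0,L)^{3N}`),
`a` = scattering length, `Y_n = 4π n a³/(3l³)`, and for constants `δ, C, c > 0`
  `G = {n : Y_n < δ ∧ Y_n^(-1/17) ≤ n}` (LSSY-admissible block fillings),
  `e(n) = 4π (n/l³) a (1 − C Y_n^(1/17)) n` (first-order energy of `n` bosons in a Neumann box of side `l`),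
  `κ = c/l²` (the Neumann gap scale), and the BLOCK FUNCTIONAL
  `Φ_K(Ψ) = ∫_{[0,L)^{3N}} Σ_B 1[n_B(X) ∈ G]·(e(n_B(X)) + κ n_B(X)) |Ψ(X)|² dX`.

* `stub_blockBracketing` (KINEMATIC, size L, provable now) — Neumann bracketing of the torus into its `K³`
  blocks AT THE LEVEL OF A STATE, with pinning: if on the Neumann box of side `l` every Bose-symmetric
  `n`-body state with `n ∈ G` obeys the form bound `e(n) + κ n ≤ ⟨Φ,H_nΦ⟩ + κ⟨Φ,n₀Φ⟩` (any `G, e, κ`), then every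
  periodic `N`-body state obeys `Φ_K(Ψ) ≤ ⟨Ψ,H_N^per Ψ⟩ + κ Σ_B ⟨u_B, γ_Ψ u_B⟩`. Mechanism: partition
  `[0,L)^{3N}` by occupation patterns; on each fibre (pattern and outside coordinates fixed) the restriction of
  `Ψ` is a `C¹` Bose-symmetric function on `Q_B^{n_B}`, to which the HOMOGENEOUS per-box inequality applies after
  translation/normalisation; cross-block pairs are dropped (`v ≥ 0`), `v ≤ v^per` (`le_periodizedPotential`),
  the kinetic terms re-sum to `∫|∇Ψ|²`, and `Σ_patterns ∫ ⟨n₀^{(B)}⟩_fibre = ⟨u_B, γ_Ψ u_B⟩` by Bose symmetry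
  (the block analogue of (5.17), cf. `condensateOccupation_add_depletion`, `LSSY2005_cellDecomposition_holds`).
* `stub_boxPinnedGapBound` (ONE BOX, size M) — the per-box input in exactly that shape for EVERY repulsive
  finite-range `v`: `∃ δ C c > 0`, for all `n`, `l > 0` with `Y_n < δ`, `Y_n^(-1/17) ≤ n` and every Bose-symmetric
  Neumann state, `e(n) + (c/l²) n ≤ ⟨Φ,H_nΦ⟩ + (c/l²)⟨Φ,n₀Φ⟩`. For `0 < a` this is VERBATIM the proved tree theorem
  `neumannBox_pinnedLowerBound_firstOrder` (LSSY Lemma 5.2 + Lemma 4.1, (5.15)–(5.17), Neumann box;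
  `a < ∞` from `scatteringLength_le_range`); what remains is the degenerate branch `a = 0` (then `Y = 0`, all `n`
  admissible, `e = 0`, and the claim is the Neumann–Poincaré bound `(c/l²)⟨Φ,n₊Φ⟩ ≤ ⟨Φ,TΦ⟩`,
  `depletion_le_of_lemma41_contDiff` with `R ≤ 0`, plus the edge `n ≤ 1`).
* `stub_blockEnergyAccounting` (ENERGETIC, size L) — first-order saturation of the block functional by
  near-minimisers, for ALL constants `δ, C, c > 0`: for every `A, η > 0` there are `ρ₀, N₀` such that on every
  dilute box, for some slack `δ' > 0`, `E₀^per(N,L) < ∞` and every `δ'`-near-minimiser and every even `K` in the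
  `A`-window satisfy `⟨Ψ,HΨ⟩ + κ(1 − η)N ≤ Φ_K(Ψ)`. Content: the upper bound `E₀^per ≤ 4πρ₁aN(1 + C₂a/b)`
  (`LSSY2005_upperBound_periodic_holds`), the energy-only bracketing `⟨Ψ,HΨ⟩ ≥ ⟨Σ_B E₀^Neu(n_B, l)⟩_Ψ`
  (stub 1 with `κ = 0`, `e = E₀^Neu(·,l)`), the per-block lower bound (2.35)/(2.54) and superadditivity (2.53)
  (`LSSY2005_lowerBound_neumann_holds`, `LSSY2005_superadditivity_holds`) to show that all but `βN` particles sit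
  in LSSY-admissible, not-overfilled blocks (`β → 0` as `ρ₀ → 0` at fixed `A`: underfilled mass `≤ K³n_min`,
  `n_min/m ≍ (l/a)^(1/6)/(ρl³) → 0`; overfilled mass is penalised super-quadratically), and Jensen
  `Σ_good n_B² ≥ (good mass)²/K³`; then `Φ_K ≥ 4πaρN(1 − ε)(1 − β)² + κ(1 − β)N` beats
  `4πaρN(1 + ε') + δ' + κ(1 − η)N` because `κ = cK²/L² ∈ [c/(4A²), c/A²]·ρ` is of the SAME ORDER `ρ` as the
  interaction energy per particle while `ε, ε', β → 0` — the healing-scale bet of the route (depletion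
  `≤ C A² a (Y^(1/17) + a/b) N`). For `a = 0`: `E₀^per = 0` by Thm 2.2 and the claim is `δ' ≤ κηN`.
* `BlockCondensation_of` — REAL PROOF (no `sorry`): stubs 1+2 give `Φ_K(Ψ) ≤ ⟨Ψ,HΨ⟩ + κ Σ_B⟨u_B,γ_Ψu_B⟩`, stub 3
  gives `⟨Ψ,HΨ⟩ + κ(1 − η)N ≤ Φ_K(Ψ)` with `⟨Ψ,HΨ⟩ ≤ E₀ + min(δ',1) < ∞`; cancel the energy
  (`ENNReal.add_le_add_iff_left`) and divide by `κ = c/l² ∈ (0,∞)` (`ENNReal.mul_le_mul_iff_right`).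
  `BlockCondensation_of_stubs : BlockCondensation` plugs the named stubs in.

Why this is not shredding / costume: stub 1 is pure kinematics (no energy asymptotics, no BEC), stub 2 is a
fixed-box statement already proved for `a > 0`, stub 3 is an energy-distribution statement that holds whether or
not anything condenses (it is implied by nothing about `γ_Ψ`); none mentions `λ_max`/`HasGroundStateBEC`, none is
the crux reworded (the crux needs all three), and the seam is the pinned form inequality, not a conjunction.
Disproof used: none on file (`ledger crux ls stmt-AtomisticToContinuum-13595`: no workfiles, no `Disproof.lean`,
no Negative lemmas); negatives index (20 entries 2026-08-17; BEC: `BECPopovBerryRG.BerryStiffPhaseLRO`,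
`BECSwapAffinity.SwapJensen`) — no stub is an instance. Degenerate cases: `a = 0` handled inside stubs 2 and 3
as above; `N = 0`/no admissible `K` vacuous exactly as for the crux; `K = 2` boxes are ordinary instances.
Refs: LSSY2005 Thm 2.2 (2.14), Thm 2.4 (2.35), (2.52)–(2.54), Lemma 4.1 (4.2), Lemma 5.2 (5.7), Thm 5.1
(5.15)–(5.17); Fournais2020 Thm 1.2; FournaisEtAl2024 Lemma 4.1; Junge2026 Thm 3/4.
-/

noncomputable section

open MeasureTheory
open scoped ENNReal NNReal BigOperators

namespace Summit.AtomisticToContinuum.BoseEinsteinCondensation.Cruxes.BlockCondensation.Birth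

open Literature.MathematicalPhysics.QuantumManyBody.BoseGas
open Summit.AtomisticToContinuum.BoseEinsteinCondensation.Theses.BECIntegerBlockRotor

/-! ## Stubs (the three open lemmas of the line; `sorry` only here)

Conventions. `l = L/K`; block `B : Fin 3 → Fin K` is `Q_B = Π_j [B_j l, (B_j+1) l)`; the block particle
number of a configuration `X` is `#{i | ∀ j, ⌊K·X i j / L⌋ = B j}`; `u_B` is written verbatim as in the crux;
`a = (scatteringLength v).toReal`; the LSSY filling parameter of `n` particles in a box of side `l` is
`Y = 4π (n/l³) a³/3`, written out in full at every occurrence (no local definitions, so that every stub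
signature elaborates over tree declarations alone). -/

/-- **Stub 1 — `stub_blockBracketing`: Neumann bracketing of the torus into `K³` blocks at the level of a
state, with a block pinning term (KINEMATIC; size L; provable now).** For every repulsive finite-range `v`,
all `N, K ≥ 1, L > 0`, every set `G` of admissible fillings, every `e : ℕ → [0,∞]` and `κ ≥ 0` (as
`ENNReal.ofReal κ`): IF every Bose-symmetric `C¹` state `Φ` of `n ∈ G` particles on the NEUMANN box of side
`L/K` satisfies the pinned form bound `e n + κ n ≤ ⟨Φ, H_n Φ⟩_Neu + κ ⟨Φ, n₀ Φ⟩`, THEN every periodic `N`-body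
state `Ψ` on the torus of side `L` satisfies
`∫_{[0,L)^{3N}} Σ_B 1[n_B(X) ∈ G]·(e(n_B(X)) + κ n_B(X)) |Ψ(X)|² dX ≤ ⟨Ψ, H_N^per Ψ⟩ + κ Σ_B ⟨u_B, γ_Ψ u_B⟩`.
Proof route: partition the cell by occupation patterns; fibrewise the restriction of `Ψ` to `Q_B^{n_B}` (outside
coordinates frozen) is `C¹` and symmetric in the inside particles, so the homogeneous per-box bound applies after
translating `Q_B` to the origin and normalising; drop cross-block pairs (`v ≥ 0`), use `v(|x|) ≤ v^per(x)`
(`le_periodizedPotential`), re-sum `Σ_B Σ_{i ∈ B} |∇ᵢΨ|² = |∇Ψ|²`, and identify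
`Σ_patterns ∫ ⟨n₀^{(B)}⟩_fibre = cellOccupation N L u_B Ψ` by Bose symmetry (block analogue of LSSY (5.17);
cf. `condensateOccupation_add_depletion`, `sum_lintegral_sliceMeanSq_of_symm`, and the energy-only cell method
`LSSY2005_cellDecomposition_holds`). With `κ = 0`, `G = ℕ`, `e = E₀^Neu(·, L/K)` it is the bracketing
`⟨Ψ,HΨ⟩ ≥ ⟨Σ_B E₀^Neu(n_B, L/K)⟩_Ψ` used inside stub 3. Why it might fail: it does not (finite sums of
non-negative lower Lebesgue integrals; degenerate fibres `Ψ|_fibre = 0` are trivial); the work is measure-theoretic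
bookkeeping (patterns, Fubini on `cellN`, change of variables per block).
[cite: LSSY2005, (2.52)–(2.53) and Ch. 5 (5.15)–(5.17)] -/
theorem stub_blockBracketing :
    ∀ v : ℝ → ℝ≥0∞, IsRepulsiveFiniteRange v →
    ∀ (N K : ℕ) (L : ℝ), 0 < L → 0 < K →
    ∀ (G : Set ℕ) (e : ℕ → ℝ≥0∞) (κ : ℝ),
      (∀ n : ℕ, n ∈ G → ∀ Φ : NeumannTrialState n (L / (K : ℝ)),
        (∀ (σ : Equiv.Perm (Fin n)) (Z : Config n), Φ.ψ (Z ∘ σ) = Φ.ψ Z) →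
        e n + ENNReal.ofReal κ * (n : ℝ≥0∞) ≤
          neumannEnergy v Φ + ENNReal.ofReal κ * condensateOccupation n (L / (K : ℝ)) Φ.ψ) →
    ∀ Ψ : PeriodicTrialState N L,
      (∫⁻ X in cellN N L,
        (∑ B : Fin 3 → Fin K,
          G.indicator (fun n : ℕ => e n + ENNReal.ofReal κ * (n : ℝ≥0∞)) ((Finset.univ.filter fun i : Fin N => ∀ j : Fin 3, ⌊(K : ℝ) * X i j / L⌋ = (((B j : Fin K) : ℕ) : ℤ)).card)) *
        ((‖Ψ.ψ X‖₊ : ℝ≥0∞) ^ 2)) ≤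
      periodicEnergy v Ψ + ENNReal.ofReal κ * ∑ B : Fin 3 → Fin K, cellOccupation N L (fun x : EuclideanSpace ℝ (Fin 3) => if (∀ j : Fin 3, ⌊(K : ℝ) * x j / L⌋ = (((B j : Fin K) : ℕ) : ℤ)) then ((((Real.sqrt ((L / (K : ℝ)) ^ 3))⁻¹ : ℝ) : ℂ)) else 0) Ψ.ψ := by
  sorry

/-- **Stub 2 — `stub_boxPinnedGapBound`: the first-order pinned lower bound on ONE Neumann box, for every
repulsive finite-range potential (size M).** There are `δ, C, c > 0` (depending on `v`) such that for all `n`,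
`l > 0` with `Y = 4π(n/l³)a³/3 < δ` and `Y^(-1/17) ≤ n`, every Bose-symmetric normalised `C¹` state on the Neumann
box `(0,l)^{3n}` satisfies `4π(n/l³)a(1 − C Y^(1/17)) n + (c/l²) n ≤ ⟨Φ, H_n Φ⟩ + (c/l²) ⟨Φ, n₀ Φ⟩`
(i.e. `H_n ≥ 4πa n² l⁻³ (1 − CY^(1/17)) + (c/l²) n₊`). For `0 < a` this is VERBATIM the proved
`neumannBox_pinnedLowerBound_firstOrder` (its hypotheses `a ≠ ⊤`, from `scatteringLength_le_range`, and `0 < a`);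
the stub removes `0 < a`: if `a = 0` then `Y = 0`, `(0:ℝ)^(-1/17) = 0`, every `n` is admissible, the energy term
vanishes and the claim is the Neumann–Poincaré bound `(c/l²)(n − ⟨Φ,n₀Φ⟩) ≤ ∫|∇Φ|²` for symmetric states
(`depletion_le_of_lemma41_contDiff` with `R ≤ 0` and `NeumannTrialState.condensateOccupation_add_depletion`,
`c = 1/C₄`; `n ≤ 1` by hand). Why it might fail: it does not; it is the tree theorem plus a degenerate branch.
[cite: LSSY2005, Lemma 4.1 (4.2), Lemma 5.2 (5.7), Ch. 5 (5.15)–(5.17)] [cite: FournaisEtAl2024, Lemma 4.1] -/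
theorem stub_boxPinnedGapBound :
    ∀ v : ℝ → ℝ≥0∞, IsRepulsiveFiniteRange v →
    ∃ δ C c : ℝ, 0 < δ ∧ 0 < C ∧ 0 < c ∧
      ∀ (n : ℕ) (l : ℝ), 0 < l →
        (4 * Real.pi * ((n : ℝ) / l ^ 3) * (scatteringLength v).toReal ^ 3 / 3) < δ →
        (4 * Real.pi * ((n : ℝ) / l ^ 3) * (scatteringLength v).toReal ^ 3 / 3) ^ (-(1 : ℝ) / 17) ≤ (n : ℝ) →
        ∀ Φ : NeumannTrialState n l,
          (∀ (σ : Equiv.Perm (Fin n)) (Z : Config n), Φ.ψ (Z ∘ σ) = Φ.ψ Z) →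
          ENNReal.ofReal (4 * Real.pi * ((n : ℝ) / l ^ 3) * (scatteringLength v).toReal * (1 - C * (4 * Real.pi * ((n : ℝ) / l ^ 3) * (scatteringLength v).toReal ^ 3 / 3) ^ ((1 : ℝ) / 17)) * (n : ℝ)) +
              ENNReal.ofReal (c / l ^ 2) * (n : ℝ≥0∞) ≤
            neumannEnergy v Φ + ENNReal.ofReal (c / l ^ 2) * condensateOccupation n l Φ.ψ := by
  sorry

/-- **Stub 3 — `stub_blockEnergyAccounting`: near-minimisers saturate the block functional to first order
(ENERGETIC; size L; the healing-scale bet of the route).** For every repulsive finite-range `v`, ALL constants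
`δ, C, c > 0`, every block constant `A > 0` and `η > 0` there are `ρ₀ > 0`, `N₀` such that for every box
(`L > 0`, `N ≥ N₀`, `N ≤ ρ₀L³`) there is a slack `δ' > 0` with `E₀^per(N,L) < ∞` and: every `δ'`-near-minimiser
`Ψ` and every even `K > 0` with `A/√(N/L³) ≤ L/K ≤ 2A/√(N/L³)` satisfy, with `l = L/K`, `κ = c/l²`,
`G = {n : Y_n < δ ∧ Y_n^(-1/17) ≤ n}`, `e(n) = 4π(n/l³)a(1 − CY_n^(1/17))n`:
`⟨Ψ, HΨ⟩ + κ (1 − η) N ≤ ∫ Σ_B 1[n_B(X) ∈ G](e(n_B(X)) + κ n_B(X)) |Ψ(X)|² dX`.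
Proof route: `⟨Ψ,HΨ⟩ ≤ E₀ + δ' ≤ 4πρ₁aN(1 + C₂a/b) + δ'` (`LSSY2005_upperBound_periodic_holds`, `2R₀ < L`,
`a/b ≍ (ρa³)^(1/3)`); energy-only bracketing (stub 1, `κ = 0`) + `LSSY2005_lowerBound_neumann_holds` +
`LSSY2005_superadditivity_holds` show that in a near-minimiser all but `βN` particles lie in blocks with
`n_min ≤ n_B ≤ M·ρl³` (`β → 0` as `ρ₀ → 0` at fixed `A`: underfilled mass `≤ K³ n_min = N n_min/(ρl³) → 0`
deterministically, overfilled mass costs `≥ (M − 2)×` the mean energy per particle); Jensen twice gives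
`∫ Σ_good e(n_B)|Ψ|² ≥ 4πaρN(1 − ε)(1 − β)²`; and `κ = cK²/L² ≥ cρ/(4A²)` is of the same order `ρ` as `4πaρ`, so
`κ(η − β)N ≥ 4πaρN(ε + ε' + 2β) + δ'` once `ρ₀` (hence `ε, ε', β`) is small and `δ' ≤ κηN/2`. Degenerate `a = 0`:
`E₀^per = 0` (Thm 2.2), `G = ℕ`, `e = 0`, the right side is `κN` and the claim is `δ' ≤ κηN`.
Why it might fail: only through the K-UNIFORMITY bookkeeping flagged by the refuter (one `δ'` for every `K` in the
window; `K = 2` boxes; hard cores) or a slip in the heavy-block convexity step — the mathematics is LSSY Ch. 2/5.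
[cite: LSSY2005, Thm 2.2 (2.14), Thm 2.4 (2.35), (2.52)–(2.54), Ch. 5 (5.15)–(5.16)] [cite: Fournais2020, Thm 1.2] -/
theorem stub_blockEnergyAccounting :
    ∀ v : ℝ → ℝ≥0∞, IsRepulsiveFiniteRange v →
    ∀ (δ C c : ℝ), 0 < δ → 0 < C → 0 < c →
    ∀ A : ℝ, 0 < A → ∀ η : ℝ, 0 < η →
    ∃ ρ₀ : ℝ, 0 < ρ₀ ∧ ∃ N₀ : ℕ, ∀ (N : ℕ) (L : ℝ), 0 < L → N₀ ≤ N → (N : ℝ) ≤ ρ₀ * L ^ 3 →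
      ∃ δ' : ℝ≥0∞, 0 < δ' ∧ periodicGroundStateEnergy v N L ≠ ⊤ ∧
      ∀ Ψ : PeriodicTrialState N L,
        periodicEnergy v Ψ ≤ periodicGroundStateEnergy v N L + δ' →
      ∀ K : ℕ, Even K → 0 < K → A / Real.sqrt ((N : ℝ) / L ^ 3) ≤ L / (K : ℝ) ∧ L / (K : ℝ) ≤ 2 * A / Real.sqrt ((N : ℝ) / L ^ 3) →
        periodicEnergy v Ψ + ENNReal.ofReal (c / (L / (K : ℝ)) ^ 2) * ENNReal.ofReal ((1 - η) * N) ≤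
          ∫⁻ X in cellN N L, (∑ B : Fin 3 → Fin K, {n : ℕ | (4 * Real.pi * ((n : ℝ) / (L / (K : ℝ)) ^ 3) * (scatteringLength v).toReal ^ 3 / 3) < δ ∧ (4 * Real.pi * ((n : ℝ) / (L / (K : ℝ)) ^ 3) * (scatteringLength v).toReal ^ 3 / 3) ^ (-(1 : ℝ) / 17) ≤ (n : ℝ)}.indicator (fun n : ℕ => ENNReal.ofReal (4 * Real.pi * ((n : ℝ) / (L / (K : ℝ)) ^ 3) * (scatteringLength v).toReal * (1 - C * (4 * Real.pi * ((n : ℝ) / (L / (K : ℝ)) ^ 3) * (scatteringLength v).toReal ^ 3 / 3) ^ ((1 : ℝ) / 17)) * (n : ℝ)) + ENNReal.ofReal (c / (L / (K : ℝ)) ^ 2) * (n : ℝ≥0∞)) ((Finset.univ.filter fun i : Fin N => ∀ j : Fin 3, ⌊(K : ℝ) * X i j / L⌋ = (((B j : Fin K) : ℕ) : ℤ)).card)) * ((‖Ψ.ψ X‖₊ : ℝ≥0∞) ^ 2) := by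
  sorry

/-! ## Composition (REAL proofs; closed axioms)

`BlockCondensation_of` takes the three stub STATEMENTS as hypotheses and concludes the crux
`Summit.AtomisticToContinuum.BoseEinsteinCondensation.Theses.BECIntegerBlockRotor.BlockCondensation` BY NAME;
`BlockCondensation_of_stubs` plugs the named stubs in (so `sorry` enters only through `stub_*`). -/

/-- **The skeleton theorem, hypotheses form.** Stub 1 (`h1`, bracketing) instantiated with the per-box data of
stub 2 (`h2`) gives `Φ_K(Ψ) ≤ ⟨Ψ,HΨ⟩ + κ·Σ_B⟨u_B,γ_Ψu_B⟩`; stub 3 (`h3`) gives `⟨Ψ,HΨ⟩ + κ(1−η)N ≤ Φ_K(Ψ)` for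
`min(δ',1)`-near-minimisers, whose energy is finite (`E₀^per ≠ ⊤`); cancelling the energy and dividing by
`κ = c/(L/K)² ∈ (0, ∞)` yields `(1 − η)N ≤ Σ_B ⟨u_B, γ_Ψ u_B⟩`, i.e. the crux with `ρ₀, N₀` of stub 3 and
`δ := min δ' 1`. [folklore] -/
theorem BlockCondensation_of
    (h1 : ∀ v : ℝ → ℝ≥0∞, IsRepulsiveFiniteRange v →
      ∀ (N K : ℕ) (L : ℝ), 0 < L → 0 < K →
      ∀ (G : Set ℕ) (e : ℕ → ℝ≥0∞) (κ : ℝ),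
        (∀ n : ℕ, n ∈ G → ∀ Φ : NeumannTrialState n (L / (K : ℝ)),
          (∀ (σ : Equiv.Perm (Fin n)) (Z : Config n), Φ.ψ (Z ∘ σ) = Φ.ψ Z) →
          e n + ENNReal.ofReal κ * (n : ℝ≥0∞) ≤
            neumannEnergy v Φ + ENNReal.ofReal κ * condensateOccupation n (L / (K : ℝ)) Φ.ψ) →
      ∀ Ψ : PeriodicTrialState N L,
        (∫⁻ X in cellN N L,
          (∑ B : Fin 3 → Fin K,
            G.indicator (fun n : ℕ => e n + ENNReal.ofReal κ * (n : ℝ≥0∞)) ((Finset.univ.filter fun i : Fin N => ∀ j : Fin 3, ⌊(K : ℝ) * X i j / L⌋ = (((B j : Fin K) : ℕ) : ℤ)).card)) *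
          ((‖Ψ.ψ X‖₊ : ℝ≥0∞) ^ 2)) ≤
        periodicEnergy v Ψ + ENNReal.ofReal κ * ∑ B : Fin 3 → Fin K, cellOccupation N L (fun x : EuclideanSpace ℝ (Fin 3) => if (∀ j : Fin 3, ⌊(K : ℝ) * x j / L⌋ = (((B j : Fin K) : ℕ) : ℤ)) then ((((Real.sqrt ((L / (K : ℝ)) ^ 3))⁻¹ : ℝ) : ℂ)) else 0) Ψ.ψ)
    (h2 : ∀ v : ℝ → ℝ≥0∞, IsRepulsiveFiniteRange v →
      ∃ δ C c : ℝ, 0 < δ ∧ 0 < C ∧ 0 < c ∧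
        ∀ (n : ℕ) (l : ℝ), 0 < l →
          (4 * Real.pi * ((n : ℝ) / l ^ 3) * (scatteringLength v).toReal ^ 3 / 3) < δ →
          (4 * Real.pi * ((n : ℝ) / l ^ 3) * (scatteringLength v).toReal ^ 3 / 3) ^ (-(1 : ℝ) / 17) ≤ (n : ℝ) →
          ∀ Φ : NeumannTrialState n l,
            (∀ (σ : Equiv.Perm (Fin n)) (Z : Config n), Φ.ψ (Z ∘ σ) = Φ.ψ Z) →
            ENNReal.ofReal (4 * Real.pi * ((n : ℝ) / l ^ 3) * (scatteringLength v).toReal * (1 - C * (4 * Real.pi * ((n : ℝ) / l ^ 3) * (scatteringLength v).toReal ^ 3 / 3) ^ ((1 : ℝ) / 17)) * (n : ℝ)) +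
                ENNReal.ofReal (c / l ^ 2) * (n : ℝ≥0∞) ≤
              neumannEnergy v Φ + ENNReal.ofReal (c / l ^ 2) * condensateOccupation n l Φ.ψ)
    (h3 : ∀ v : ℝ → ℝ≥0∞, IsRepulsiveFiniteRange v →
      ∀ (δ C c : ℝ), 0 < δ → 0 < C → 0 < c →
      ∀ A : ℝ, 0 < A → ∀ η : ℝ, 0 < η →
      ∃ ρ₀ : ℝ, 0 < ρ₀ ∧ ∃ N₀ : ℕ, ∀ (N : ℕ) (L : ℝ), 0 < L → N₀ ≤ N → (N : ℝ) ≤ ρ₀ * L ^ 3 →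
        ∃ δ' : ℝ≥0∞, 0 < δ' ∧ periodicGroundStateEnergy v N L ≠ ⊤ ∧
        ∀ Ψ : PeriodicTrialState N L,
          periodicEnergy v Ψ ≤ periodicGroundStateEnergy v N L + δ' →
        ∀ K : ℕ, Even K → 0 < K → A / Real.sqrt ((N : ℝ) / L ^ 3) ≤ L / (K : ℝ) ∧ L / (K : ℝ) ≤ 2 * A / Real.sqrt ((N : ℝ) / L ^ 3) →
          periodicEnergy v Ψ + ENNReal.ofReal (c / (L / (K : ℝ)) ^ 2) * ENNReal.ofReal ((1 - η) * N) ≤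
            ∫⁻ X in cellN N L, (∑ B : Fin 3 → Fin K, {n : ℕ | (4 * Real.pi * ((n : ℝ) / (L / (K : ℝ)) ^ 3) * (scatteringLength v).toReal ^ 3 / 3) < δ ∧ (4 * Real.pi * ((n : ℝ) / (L / (K : ℝ)) ^ 3) * (scatteringLength v).toReal ^ 3 / 3) ^ (-(1 : ℝ) / 17) ≤ (n : ℝ)}.indicator (fun n : ℕ => ENNReal.ofReal (4 * Real.pi * ((n : ℝ) / (L / (K : ℝ)) ^ 3) * (scatteringLength v).toReal * (1 - C * (4 * Real.pi * ((n : ℝ) / (L / (K : ℝ)) ^ 3) * (scatteringLength v).toReal ^ 3 / 3) ^ ((1 : ℝ) / 17)) * (n : ℝ)) + ENNReal.ofReal (c / (L / (K : ℝ)) ^ 2) * (n : ℝ≥0∞)) ((Finset.univ.filter fun i : Fin N => ∀ j : Fin 3, ⌊(K : ℝ) * X i j / L⌋ = (((B j : Fin K) : ℕ) : ℤ)).card)) * ((‖Ψ.ψ X‖₊ : ℝ≥0∞) ^ 2)) :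
    BlockCondensation := by
  intro v hv A hA η hη
  obtain ⟨δ, C, c, hδ, hC, hc, H2⟩ := h2 v hv
  obtain ⟨ρ₀, hρ₀, N₀, H3⟩ := h3 v hv δ C c hδ hC hc A hA η hη
  refine ⟨ρ₀, hρ₀, N₀, fun N L hL hN hNL => ?_⟩
  obtain ⟨δ', hδ', hE₀, H3'⟩ := H3 N L hL hN hNL
  refine ⟨min δ' 1, lt_min hδ' one_pos, fun Ψ hΨ K hK hK0 hwin => ?_⟩
  have hKr : (0 : ℝ) < (K : ℝ) := by exact_mod_cast hK0
  have hl : 0 < L / (K : ℝ) := div_pos hL hKr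
  -- stub 3: first-order saturation of the block functional by the near-minimiser `Ψ`
  have hsat := H3' Ψ (hΨ.trans (add_le_add le_rfl (min_le_left _ _))) K hK hK0 hwin
  -- stubs 1 + 2: the block pinned lower bound for `Ψ`
  have hpin := h1 v hv N K L hL hK0
    {n : ℕ | (4 * Real.pi * ((n : ℝ) / (L / (K : ℝ)) ^ 3) * (scatteringLength v).toReal ^ 3 / 3) < δ ∧ (4 * Real.pi * ((n : ℝ) / (L / (K : ℝ)) ^ 3) * (scatteringLength v).toReal ^ 3 / 3) ^ (-(1 : ℝ) / 17) ≤ (n : ℝ)}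
    (fun n : ℕ => ENNReal.ofReal (4 * Real.pi * ((n : ℝ) / (L / (K : ℝ)) ^ 3) * (scatteringLength v).toReal * (1 - C * (4 * Real.pi * ((n : ℝ) / (L / (K : ℝ)) ^ 3) * (scatteringLength v).toReal ^ 3 / 3) ^ ((1 : ℝ) / 17)) * (n : ℝ)))
    (c / (L / (K : ℝ)) ^ 2)
    (fun n hn Φ hΦ => H2 n (L / (K : ℝ)) hl hn.1 hn.2 Φ hΦ) Ψ
  -- the energy of the near-minimiser is finite
  have hslack : periodicGroundStateEnergy v N L + min δ' 1 ≠ ⊤ :=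
    ENNReal.add_ne_top.2 ⟨hE₀, ne_top_of_le_ne_top ENNReal.one_ne_top (min_le_right _ _)⟩
  have hEfin : periodicEnergy v Ψ ≠ ⊤ := ne_top_of_le_ne_top hslack hΨ
  -- cancel the energy and divide by `κ = c/(L/K)²`
  have hκ0 : ENNReal.ofReal (c / (L / (K : ℝ)) ^ 2) ≠ 0 := by
    rw [ne_eq, ENNReal.ofReal_eq_zero, not_le]; positivity
  have hchain := (ENNReal.add_le_add_iff_left hEfin).1 (hsat.trans hpin)
  exact (ENNReal.mul_le_mul_iff_right hκ0 ENNReal.ofReal_ne_top).1 hchain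

/-- **The skeleton theorem, closed form**: the three NAMED stubs imply the crux `BlockCondensation` (by name).
`sorry` enters only through `stub_blockBracketing`, `stub_boxPinnedGapBound`, `stub_blockEnergyAccounting`.
[folklore] -/
theorem BlockCondensation_of_stubs : BlockCondensation :=
  BlockCondensation_of stub_blockBracketing stub_boxPinnedGapBound stub_blockEnergyAccounting

/-- Read-back: the crux decl is, verbatim, the statement targeted above. [folklore] -/
example : BlockCondensation ↔
    (∀ v : ℝ → ℝ≥0∞, IsRepulsiveFiniteRange v → ∀ A : ℝ, 0 < A → ∀ η : ℝ, 0 < η →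
        ∃ ρ₀ : ℝ, 0 < ρ₀ ∧ ∃ N₀ : ℕ, ∀ (N : ℕ) (L : ℝ), 0 < L → N₀ ≤ N → (N : ℝ) ≤ ρ₀ * L ^ 3 →
        ∃ δ : ℝ≥0∞, 0 < δ ∧ ∀ Ψ : PeriodicTrialState N L,
          periodicEnergy v Ψ ≤ periodicGroundStateEnergy v N L + δ →
        ∀ K : ℕ, Even K → 0 < K → A / Real.sqrt ((N : ℝ) / L ^ 3) ≤ L / (K : ℝ) ∧ L / (K : ℝ) ≤ 2 * A / Real.sqrt ((N : ℝ) / L ^ 3) →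
          ENNReal.ofReal ((1 - η) * N) ≤ ∑ B : Fin 3 → Fin K, cellOccupation N L (fun x : EuclideanSpace ℝ (Fin 3) => if (∀ j : Fin 3, ⌊(K : ℝ) * x j / L⌋ = (((B j : Fin K) : ℕ) : ℤ)) then ((((Real.sqrt ((L / (K : ℝ)) ^ 3))⁻¹ : ℝ) : ℂ)) else 0) Ψ.ψ) :=
  Iff.rfl

end Summit.AtomisticToContinuum.BoseEinsteinCondensation.Cruxes.BlockCondensation.Birth

end
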